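import Summits.HodgeConjecture.HodgeConjecture.Theorems.CYFormCasimirCYFormCarrierEightPairedCoords
import Summits.HodgeConjecture.HodgeConjecture.Theorems.CYFormCasimirCYFormCarrierEightBetaPairing
import HarnessLib

/-!
# Crux X1 `CYFormCarrierEight` (route `CYFormCasimir`, stmt-HodgeConjecture-23493), helper file 10:
# products of disjoint monomials are monomials up to sign; the diagonal of `β` is non-zero

research route conditional on HC_CM; not a corollary. Nothing here proves HC, HC_CM, the rung H2, X1 or `stub_cyform_exists`;
step S1 (second half) of `Cruxes/CYFormCarrierEight/STUB-PLAN-stub_cyform_exists.md`.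

* `cupProduct_monB_monB_of_disjoint` — for index sets `s`, `t` with disjoint underlying finsets and `u = s ∪ t`,
  `b_s ∪ b_t = ε • b_u` with `ε = ±1` (`ε * ε = 1`): the product of two iterated products of basis classes is the
  iterated product over the concatenated family, which is a permutation of the increasing family of `u`; alternating
  maps pick up the sign of the permutation (Mathlib `AlternatingMap.map_perm`).
* `beta_monB_diag_ne_zero` — in the Weil frame of a Hodge-general Weil eightfold, **`β(w_I, w^*_I) = tr((w_I ∪ w^*_I) ∪ h_K⁴) ≠ 0`
  for every `I`**: `w_I ∪ w^*_I = ± b_{P(I)}` (paired monomial), only the paired monomial `b_{P(Iᶜ)}` of `h_K⁴` survives the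
  product (`b_{P(I)} ∪ b_{P(Iᶜ)} = ± b_{top} ≠ 0`, all other monomials share an index with `P(I)`), and its coefficient is
  non-zero (helper file 9). With helper file 8 (`β(w_I, w^*_K) = 0`, `I ≠ K`): **`β` is a PERFECT pairing between `⋀⁴W` and
  `⋀⁴W^*`, diagonal in the Weil frame** — the input for the duality definition of the Hodge star (step S2).

References: vanGeemen1994HodgeAV (proof of Thm. 6.12), FriedmanLaza2013 (§3.5 Lemma 36), LangeBirkenhake1992 (Lemma 1.1.17).
-/

-- `Summit.HodgeConjecture.HodgeConjecture.…` is the tree's mandated summit/problem namespace (single-problem summit).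
set_option linter.dupNamespace false
noncomputable section

open CategoryTheory
open Literature.AlgebraicTopology.SingularHomology
open Literature.AlgebraicGeometry.Motives
open Literature.AlgebraicGeometry.HodgeTheory
open Literature.AlgebraicGeometry.VanGeemen1994

namespace Summit.HodgeConjecture.HodgeConjecture.Theorems.CYFormCarrier

/-! ## §1 Products of disjoint monomials -/

section Monomials

variable {A : AbelianVariety ℂ} {N : ℕ}

/-- **`b_s ∪ b_t = ± b_{s ∪ t}` for disjoint index sets.** [cite: LangeBirkenhake1992, Lemma 1.1.17] -/
theorem cupProduct_monB_monB_of_disjoint (b : Module.Basis (Fin N) ℂ (complexBetti A.X 1)) {q q' m : ℕ}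
    (h : q + q' = m) (s : Set.powersetCard (Fin N) q) (t : Set.powersetCard (Fin N) q') (u : Set.powersetCard (Fin N) m)
    (hst : Disjoint s.val t.val) (hu : u.val = s.val ∪ t.val) :
    ∃ ε : ℂ, ε * ε = 1 ∧ cupProduct h (monB b q s) (monB b q' t) = ε • monB b m u := by
  classical
  subst h
  -- the concatenated index family
  set es : Fin q → Fin N := fun r ↦ s.val.orderEmbOfFin s.prop r with hes
  set et : Fin q' → Fin N := fun r ↦ t.val.orderEmbOfFin t.prop r with het
  set eu : Fin (q + q') → Fin N := fun r ↦ u.val.orderEmbOfFin u.prop r with heu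
  set g : Fin (q + q') → Fin N := Fin.append es et with hg
  have hg_mem : ∀ r, g r ∈ u.val := by
    intro r
    refine Fin.addCases (fun i ↦ ?_) (fun j ↦ ?_) r
    · rw [hg, Fin.append_left, hu]; exact Finset.mem_union_left _ (s.val.orderEmbOfFin_mem s.prop i)
    · rw [hg, Fin.append_right, hu]; exact Finset.mem_union_right _ (t.val.orderEmbOfFin_mem t.prop j)
  have hg_inj : Function.Injective g := by
    intro x y hxy
    induction x using Fin.addCases with
    | left i =>
      induction y using Fin.addCases with
      | left i' =>
        rw [hg, Fin.append_left, Fin.append_left] at hxy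
        rw [(s.val.orderEmbOfFin s.prop).injective hxy]
      | right j' =>
        rw [hg, Fin.append_left, Fin.append_right] at hxy
        have h1 : es i ∈ s.val := s.val.orderEmbOfFin_mem s.prop i
        rw [hxy] at h1
        exact absurd h1 (Finset.disjoint_right.1 hst (t.val.orderEmbOfFin_mem t.prop j'))
    | right j =>
      induction y using Fin.addCases with
      | left i' =>
        rw [hg, Fin.append_right, Fin.append_left] at hxy
        have h1 : es i' ∈ s.val := s.val.orderEmbOfFin_mem s.prop i'
        rw [← hxy] at h1
        exact absurd h1 (Finset.disjoint_right.1 hst (t.val.orderEmbOfFin_mem t.prop j))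
      | right j' =>
        rw [hg, Fin.append_right, Fin.append_right] at hxy
        rw [(t.val.orderEmbOfFin t.prop).injective hxy]
  -- the permutation `π` with `eu ∘ π = g`
  set π : Fin (q + q') → Fin (q + q') := fun r ↦ (u.val.orderIsoOfFin u.prop).symm ⟨g r, hg_mem r⟩ with hπ
  have hπg : ∀ r, eu (π r) = g r := by
    intro r
    rw [heu]
    change ((u.val.orderIsoOfFin u.prop) ((u.val.orderIsoOfFin u.prop).symm ⟨g r, hg_mem r⟩) : Fin N) = g r
    rw [OrderIso.apply_symm_apply]
  have hπ_inj : Function.Injective π := by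
    intro x y hxy
    apply hg_inj
    rw [← hπg x, ← hπg y, hxy]
  obtain ⟨σ, hσ⟩ : ∃ σ : Equiv.Perm (Fin (q + q')), ∀ r, σ r = π r :=
    ⟨Equiv.ofBijective π (Finite.injective_iff_bijective.1 hπ_inj), fun r ↦ rfl⟩
  refine ⟨(Equiv.Perm.sign σ : ℂ), ?_, ?_⟩
  · rcases Int.units_eq_one_or (Equiv.Perm.sign σ) with h1 | h1 <;> rw [h1] <;> simp
  rw [monB_apply, monB_apply, monB_apply, cupProduct_cupPowOne_cupPowOne]
  have hfam : Fin.append (fun r ↦ b (s.val.orderEmbOfFin s.prop r)) (fun r ↦ b (t.val.orderEmbOfFin t.prop r)) =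
      (fun r ↦ b (u.val.orderEmbOfFin u.prop r)) ∘ σ := by
    funext r
    rw [Function.comp_apply, hσ r]
    change _ = b (eu (π r))
    rw [hπg r]
    refine Fin.addCases (fun i ↦ ?_) (fun j ↦ ?_) r
    · rw [Fin.append_left, hg, Fin.append_left]
    · rw [Fin.append_right, hg, Fin.append_right]
  rw [hfam, ← cupPowOneAlt_apply, AlternatingMap.map_perm, cupPowOneAlt_apply, Units.smul_def, Int.cast_smul_eq_zsmul]

end Monomials

/-! ## §2 The diagonal of `β` is non-zero -/

section BetaDiag

variable {A : AbelianVariety ℂ} {d : ℕ} {φ : A ⟶ A}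
variable (hn : 2 ≤ 4) (hd : 0 < d) (hA : A.dim = 2 * 4) (hφ : φ ≫ φ = -(d • 𝟙 A))
  (e : ProjectiveEmbedding A.X) {a : complexBetti (projectiveSpace e.n ℂ) 2} (ha : IsRationalClass a)
  (ha0 : a ≠ 0)

/-- The paired index set `castAdd(I) ⊔ natAdd(I)` of a `q`-subset `I`. [cite: vanGeemen1994HodgeAV, proof of Thm. 6.12] -/
theorem disjoint_map_castAddEmb_map_natAddEmb {k q : ℕ} (I J : Set.powersetCard (Fin k) q) :
    Disjoint (Set.powersetCard.map q (Fin.castAddEmb k) I).val (Set.powersetCard.map q (Fin.natAddEmb k) J).val := by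
  rw [Set.powersetCard.val_map, Set.powersetCard.val_map, Finset.disjoint_left]
  rintro p hp hp'
  obtain ⟨i, -, rfl⟩ := Finset.mem_map.1 hp
  obtain ⟨j, -, hj⟩ := Finset.mem_map.1 hp'
  have := congrArg Fin.val hj
  simp [Fin.val_castAdd] at this
  omega

/-- The union `castAdd(I) ∪ natAdd(I)` is paired. [cite: vanGeemen1994HodgeAV, proof of Thm. 6.12] -/
theorem isPaired_union {k q : ℕ} (I : Set.powersetCard (Fin k) q) :
    IsPaired ((Set.powersetCard.map q (Fin.castAddEmb k) I).val ∪ (Set.powersetCard.map q (Fin.natAddEmb k) I).val) := by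
  intro i
  rw [Finset.mem_union, Finset.mem_union, Set.powersetCard.val_map, Set.powersetCard.val_map,
    CYFormSquare.castAdd_mem_map_castAddEmb_iff, CYFormSquare.natAdd_mem_map_natAddEmb_iff]
  constructor
  · rintro (h | h)
    · exact Or.inr h
    · exact absurd h CYFormSquare.castAdd_not_mem_map_natAddEmb'
  · rintro (h | h)
    · exact absurd h CYFormSquare.natAdd_not_mem_map_castAddEmb'
    · exact Or.inl h

include hn hd hA hφ e ha ha0 in
/-- **`β(w_I, w^*_I) ≠ 0`**: the diagonal of the duality pairing `β(x, y) = tr((x ∪ y) ∪ h_K⁴)` in the Weil frame of a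
Hodge-general `ℚ(√-d)`-Weil eightfold is non-zero. Proof: `w_I ∪ w^*_I = ± b_{P(I)}`; in `b_{P(I)} ∪ h_K⁴ = Σ_s c_s b_{P(I)} ∪ b_s`
only `s = P(Iᶜ)` (the complement of `P(I)`) survives, `b_{P(I)} ∪ b_{P(Iᶜ)} = ± b_{top} ≠ 0`, and `c_{P(Iᶜ)} ≠ 0` since
`P(Iᶜ)` is paired (helper file 9). [cite: vanGeemen1994HodgeAV, proof of Thm. 6.12] [cite: FriedmanLaza2013, §3.5 Lemma 36] -/
theorem beta_monB_diag_ne_zero (hSU : HasHodgeGroupSU A φ 4 d (hK d φ e a))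
    (I : Set.powersetCard (Fin (2 * 4)) (2 * 2)) :
    topCoord (dim_eq_seven_add_one hA)
        (cupProduct (show 2 * 4 + 2 * 4 = 2 + 2 * 7 from rfl)
          (cupProduct (show 2 * 2 + 2 * 2 = 2 * 4 from rfl)
            (monB (bW hn hd hA hφ e ha ha0) (2 * 2) (Set.powersetCard.map (2 * 2) (Fin.castAddEmb (2 * 4)) I))
            (monB (bW hn hd hA hφ e ha ha0) (2 * 2) (Set.powersetCard.map (2 * 2) (Fin.natAddEmb (2 * 4)) I)))
          (cupPowTwo (hK d φ e a) 4)) ≠ 0 := by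
  classical
  set b := bW hn hd hA hφ e ha ha0 with hb
  set B := monB b (2 * 4) with hB
  -- `P(I)` and its complement
  have hcardP : ((Set.powersetCard.map (2 * 2) (Fin.castAddEmb (2 * 4)) I).val ∪
      (Set.powersetCard.map (2 * 2) (Fin.natAddEmb (2 * 4)) I).val).card = 2 * 4 := by
    rw [Finset.card_union_of_disjoint (disjoint_map_castAddEmb_map_natAddEmb I I), Set.powersetCard.card_eq,
      Set.powersetCard.card_eq]
  set P : Set.powersetCard (Fin (2 * 4 + 2 * 4)) (2 * 4) := Set.powersetCard.ofCard hcardP with hP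
  have hPpaired : IsPaired P.val := isPaired_union I
  have hcardQ : (P.valᶜ).card = 2 * 4 := by
    rw [Finset.card_compl, Set.powersetCard.card_eq, Fintype.card_fin]
  set Q : Set.powersetCard (Fin (2 * 4 + 2 * 4)) (2 * 4) := Set.powersetCard.ofCard hcardQ with hQ
  have hQpaired : IsPaired Q.val := by
    intro i
    change Fin.castAdd (2 * 4) i ∈ P.valᶜ ↔ Fin.natAdd (2 * 4) i ∈ P.valᶜ
    rw [Finset.mem_compl, Finset.mem_compl, hPpaired i]
  have hcardT : (P.val ∪ Q.val).card = 2 * 4 + 2 * 4 := by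
    change (P.val ∪ P.valᶜ).card = _
    rw [Finset.union_compl, Finset.card_univ, Fintype.card_fin]
  set T : Set.powersetCard (Fin (2 * 4 + 2 * 4)) (2 * 4 + 2 * 4) := Set.powersetCard.ofCard hcardT with hT
  -- `w_I ∪ w^*_I = ε₁ b_P`
  obtain ⟨ε₁, hε₁, h₁⟩ := cupProduct_monB_monB_of_disjoint b (show 2 * 2 + 2 * 2 = 2 * 4 from rfl) _ _ P
    (disjoint_map_castAddEmb_map_natAddEmb I I) rfl
  -- `b_P ∪ b_Q = ε₂ b_T ≠ 0`
  obtain ⟨ε₂, hε₂, h₂⟩ := cupProduct_monB_monB_of_disjoint b (show 2 * 4 + 2 * 4 = 2 + 2 * 7 from rfl) P Q T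
    (by change Disjoint P.val P.valᶜ; exact disjoint_compl_right) rfl
  -- expand `h_K⁴` in the monomial basis and kill every term but `Q`
  have hsum : cupProduct (show 2 * 4 + 2 * 4 = 2 + 2 * 7 from rfl) (monB b (2 * 4) P) (cupPowTwo (hK d φ e a) 4) =
      (B.repr (cupPowTwo (hK d φ e a) 4) Q * ε₂) • monB b (2 + 2 * 7) T := by
    conv_lhs => rw [← B.sum_repr (cupPowTwo (hK d φ e a) 4)]
    rw [map_sum, Finset.sum_eq_single Q]
    · rw [map_smul, hB, h₂, smul_smul]
    · intro s _ hs
      -- `s ≠ Q` of cardinality `8` meets `P`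
      have hmeet : ∃ j, j ∈ P.val ∧ j ∈ s.val := by
        by_contra hno
        push Not at hno
        apply hs
        apply Subtype.ext
        refine (Finset.eq_of_subset_of_card_le (fun j hj ↦ ?_) ?_)
        · change j ∈ P.valᶜ
          rw [Finset.mem_compl]
          exact fun hjP ↦ hno j hjP hj
        · rw [Set.powersetCard.card_eq, Set.powersetCard.card_eq]
      obtain ⟨j, hjP, hjs⟩ := hmeet
      rw [map_smul, hB, CYFormSquare.cupProduct_monB_monB_eq_zero_of_mem b _ P s hjP hjs, smul_zero]
    · intro h; exact absurd (Finset.mem_univ Q) h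
  -- assemble
  rw [h₁, LinearMap.map_smul₂, hsum, map_smul, map_smul, smul_eq_mul, smul_eq_mul]
  have hT0 : topCoord (dim_eq_seven_add_one hA) (monB b (2 + 2 * 7) T) ≠ 0 := by
    intro h0
    have h := topCoord_smul_topGen (dim_eq_seven_add_one hA) (monB b (2 + 2 * 7) T)
    rw [h0, zero_smul] at h
    exact (Module.Basis.ne_zero (monB b (2 + 2 * 7)) T) h.symm
  have hQ0 : B.repr (cupPowTwo (hK d φ e a) 4) Q ≠ 0 :=
    repr_cupPowTwo_hK_four_ne_zero_of_isPaired hn hd hA hφ e ha ha0 hSU Q hQpaired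
  have hε₁0 : ε₁ ≠ 0 := fun h ↦ by rw [h, mul_zero] at hε₁; exact zero_ne_one hε₁
  have hε₂0 : ε₂ ≠ 0 := fun h ↦ by rw [h, mul_zero] at hε₂; exact zero_ne_one hε₂
  exact mul_ne_zero hε₁0 (mul_ne_zero (mul_ne_zero hQ0 hε₂0) hT0)

end BetaDiag

end Summit.HodgeConjecture.HodgeConjecture.Theorems.CYFormCarrier

end
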